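import Mathlib
import Literature.Analysis.FluidPDE.NormalisedPressureL2Bound
import Literature.Analysis.FluidPDE.PressureRepresentation
import Literature.Analysis.FluidPDE.FlatSwirlGauge
import Literature.Analysis.FluidPDE.NewtonPotential
import Literature.Analysis.FluidPDE.RieszPressureLocality
import Summits.NavierStokesRegularity.NavierStokesRegularity.Theorems.EulerZoomLiouvillePowerGaugeEulerLiouvilleSelfSimilarEndpointRieszScale
import HarnessLib

/-!
# Rung C1 of the crux `EulerZoomLiouville.PowerGaugeEulerLiouville`: consistency in the scale of
# the scale-wise Riesz pressure `Q_R = Π[V·1_{B_R}] + ∫_{|z| ≥ R} K(·−z)(V z) dz`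

Route №10 `EulerZoomLiouville` (NavierStokesRegularity), crux E = stmt-NavierStokesRegularity-19832,
rung C1 at the endpoint.  The endpoint stratum (`…SelfSimilarEndpointMember`) assumes that the
pressure profile is, below `|y| < R/2`, the Riesz pressure of the near field `V·1_{B_R}` plus the
honest kernel integral of the far field.  For `V ∈ L²` only (no global `L³`) this scale-wise object
is the substitute for the whole-space Riesz pressure; this file proves its two structural
properties, for `V ∈ L² ∩ L³_loc`:

* `integrableOn_pressureKernel_far` — the far kernel integrand is integrable for `‖y‖ ≤ R/2`;
* `scaleQ_ae_eq_of_le` — CONSISTENCY: `Q_R = Q_{R'}` a.e. on `B_{R/2}` for `R ≤ R'` (additivity of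
  the Riesz pressure over disjoint supports + its far-field representation on the inner ball).

WHAT THIS IS NOT: not NS, not E, not rung C1 — harmonic-analysis plumbing; the identification of
the pressure profile with `Q_R` is the sequel.
-/

noncomputable section

-- flat `Theorems/<Route><Decl>…` files of one crux share the namespace of the crux (tree convention)
set_option linter.dupNamespace false

open MeasureTheory Set Filter Topology Metric Function TopologicalSpace InnerProductSpace
open scoped ENNReal NNReal InnerProductSpace RealInnerProductSpace Laplacian

namespace Summit.NavierStokesRegularity.NavierStokesRegularity.Theorems.PowerGaugeEulerLiouville

open Literature.Analysis Literature.Analysis.FunctionSpaces Literature.Analysis.FluidPDE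

variable {V : EuclideanSpace ℝ (Fin 3) → EuclideanSpace ℝ (Fin 3)}

section Consistency

/-- Integrability of the far kernel integrand against an `L²` field away from the evaluation
point: for `‖y‖ ≤ R/2`, `z ↦ K(y−z)(V z)` is integrable on `{|z| ≥ R}`. [folklore] -/
theorem integrableOn_pressureKernel_far (hVm : AEStronglyMeasurable V volume)
    (hV2 : Integrable (fun z => ‖V z‖ ^ 2) volume) {R : ℝ} (hR : 0 < R)
    {y : EuclideanSpace ℝ (Fin 3)} (hy : ‖y‖ ≤ R / 2) :
    IntegrableOn (fun z => pressureKernel (y - z) (V z)) {z | R ≤ ‖z‖} volume := by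
  have hSm : MeasurableSet {z : EuclideanSpace ℝ (Fin 3) | R ≤ ‖z‖} :=
    measurableSet_le measurable_const measurable_norm
  have hmeas : AEStronglyMeasurable (fun z => pressureKernel (y - z) (V z))
      ((volume : Measure (EuclideanSpace ℝ (Fin 3))).restrict {z | R ≤ ‖z‖}) :=
    (aestronglyMeasurable_pressureKernel_sub_apply hVm y).restrict
  have hdom : Integrable (fun z => ‖V z‖ ^ 2 / (2 * Real.pi * (R / 2) ^ 3))
      ((volume : Measure (EuclideanSpace ℝ (Fin 3))).restrict {z | R ≤ ‖z‖}) :=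
    (hV2.div_const (2 * Real.pi * (R / 2) ^ 3)).restrict
  refine Integrable.mono' hdom hmeas ?_
  rw [ae_restrict_iff' hSm]
  refine Eventually.of_forall fun z hz => ?_
  rw [Real.norm_eq_abs]
  have hz' : R ≤ ‖z‖ := hz
  have hyz : R / 2 ≤ ‖y - z‖ := by
    have : ‖z‖ - ‖y‖ ≤ ‖y - z‖ := by rw [norm_sub_rev]; exact norm_sub_norm_le z y
    linarith
  calc |pressureKernel (y - z) (V z)| ≤ ‖V z‖ ^ 2 / (2 * Real.pi * ‖y - z‖ ^ 3) :=
        abs_pressureKernel_le _ _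
    _ ≤ ‖V z‖ ^ 2 / (2 * Real.pi * (R / 2) ^ 3) := by
        have : 0 < R / 2 := by positivity
        gcongr

/-- **Consistency of the scale-wise Riesz pressure.**  For `V ∈ L² ∩ L³_loc` and
`0 < R ≤ R'`, a.e. on `B_{R/2}`:
`Π[V·1_{B_R}] + ∫_{|z| ≥ R} K(·−z)(V z) = Π[V·1_{B_{R'}}] + ∫_{|z| ≥ R'} K(·−z)(V z)`
(additivity of `Π` over `B_R` and the annulus `R ≤ |z| < R'`, and the far-field representation
of the annulus' Riesz pressure on `B_{R/2}`). [cite: RobinsonRodrigoSadowski2016, proof of Lemma 15.12 p. 232] -/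
theorem scaleQ_ae_eq_of_le (hVm : AEStronglyMeasurable V volume)
    (hV2 : Integrable (fun z => ‖V z‖ ^ 2) volume)
    (hV3 : LocallyIntegrable (fun y => ‖V y‖ ^ 3) volume) {R R' : ℝ} (hR : 0 < R) (hRR' : R ≤ R') :
    ∀ᵐ y : EuclideanSpace ℝ (Fin 3), ‖y‖ < R / 2 →
      rieszPressure ((ball (0 : EuclideanSpace ℝ (Fin 3)) R).indicator V) y +
          ∫ z in {z | R ≤ ‖z‖}, pressureKernel (y - z) (V z) =
        rieszPressure ((ball (0 : EuclideanSpace ℝ (Fin 3)) R').indicator V) y +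
          ∫ z in {z | R' ≤ ‖z‖}, pressureKernel (y - z) (V z) := by
  set A : Set (EuclideanSpace ℝ (Fin 3)) := {z | R ≤ ‖z‖ ∧ ‖z‖ < R'} with hA
  have hAm : MeasurableSet A := (measurableSet_le measurable_const measurable_norm).inter
    (measurableSet_lt measurable_norm measurable_const)
  set UR := (ball (0 : EuclideanSpace ℝ (Fin 3)) R).indicator V with hUR
  set UR' := (ball (0 : EuclideanSpace ℝ (Fin 3)) R').indicator V with hUR'
  set UA := A.indicator V with hUA
  have hUR3 : MemLp UR 3 volume :=
    memLp_indicator_three_of_subset hVm hV3 measurableSet_ball ball_subset_closedBall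
  have hUR'3 : MemLp UR' 3 volume :=
    memLp_indicator_three_of_subset hVm hV3 measurableSet_ball ball_subset_closedBall
  have hUA3 : MemLp UA 3 volume :=
    memLp_indicator_three_of_subset hVm hV3 hAm (R := R') fun z hz => by
      rw [mem_closedBall, dist_zero_right]; exact hz.2.le
  -- additivity `Π[UR'] = Π[UR] + Π[UA]`
  have hadd : rieszPressure UR' =ᵐ[volume] fun y => rieszPressure UR y + rieszPressure UA y := by
    refine rieszPressure_add_ae_eq_of_disjoint hUR'3 hUR3 hUA3 (fun y => ?_)
      (Eventually.of_forall fun y => ?_)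
    · by_cases hy : y ∈ ball (0 : EuclideanSpace ℝ (Fin 3)) R
      · right; rw [hUA, indicator_of_notMem]
        intro hyA; rw [mem_ball, dist_zero_right] at hy; linarith [hyA.1]
      · left; rw [hUR, indicator_of_notMem hy]
    · show UR' y = UR y + UA y
      by_cases h1 : y ∈ ball (0 : EuclideanSpace ℝ (Fin 3)) R
      · have h1' : ‖y‖ < R := by rwa [mem_ball, dist_zero_right] at h1
        have hR' : y ∈ ball (0 : EuclideanSpace ℝ (Fin 3)) R' := by
          rw [mem_ball, dist_zero_right]; linarith
        have hA' : y ∉ A := fun h => by linarith [h.1]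
        rw [hUR', hUR, hUA, indicator_of_mem hR', indicator_of_mem h1, indicator_of_notMem hA',
          add_zero]
      · have h1' : R ≤ ‖y‖ := by rwa [mem_ball, dist_zero_right, not_lt] at h1
        by_cases h2 : ‖y‖ < R'
        · have hR' : y ∈ ball (0 : EuclideanSpace ℝ (Fin 3)) R' := by
            rwa [mem_ball, dist_zero_right]
          rw [hUR', hUR, hUA, indicator_of_mem hR', indicator_of_notMem h1,
            indicator_of_mem (show y ∈ A from ⟨h1', h2⟩), zero_add]
        · have hR' : y ∉ ball (0 : EuclideanSpace ℝ (Fin 3)) R' := by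
            rwa [mem_ball, dist_zero_right]
          have hA' : y ∉ A := fun h => h2 h.2
          rw [hUR', hUR, hUA, indicator_of_notMem hR', indicator_of_notMem h1,
            indicator_of_notMem hA', add_zero]
  -- far-field representation of `Π[UA]` on `B_{R/2}`
  have hrep := rieszPressure_ae_eq_integral_pressureKernel (a := 0) hUA3
    (by positivity : 0 < R / 2) (by linarith : R / 2 < R)
    (fun z hz => by
      rw [hUA, indicator_of_notMem]
      intro hzA; rw [mem_ball, dist_zero_right] at hz; linarith [hzA.1])
    (fun z hz => by
      rw [hUA, indicator_of_notMem]
      intro hzA; apply hz; rw [mem_closedBall, dist_zero_right]; exact hzA.2.le)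
  rw [ae_restrict_iff' measurableSet_ball] at hrep
  filter_upwards [hadd, hrep] with y hya hyr hy
  have hyb : y ∈ ball (0 : EuclideanSpace ℝ (Fin 3)) (R / 2) := by rwa [mem_ball, dist_zero_right]
  have hrep' := hyr hyb
  -- `∫ K(y−z)(UA z) dz = ∫_A K(y−z)(V z) dz`
  have hUAint : ∫ z, pressureKernel (y - z) (UA z) = ∫ z in A, pressureKernel (y - z) (V z) := by
    rw [← integral_indicator hAm]
    congr 1; funext z
    by_cases hz : z ∈ A
    · rw [hUA, indicator_of_mem hz, indicator_of_mem hz]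
    · rw [hUA, indicator_of_notMem hz, indicator_of_notMem hz, pressureKernel_zero_right]
  -- split the far integral at `R'`
  have hunion : {z : EuclideanSpace ℝ (Fin 3) | R ≤ ‖z‖} = A ∪ {z | R' ≤ ‖z‖} := by
    ext z
    simp only [mem_setOf_eq, mem_union, hA]
    constructor
    · intro hz
      by_cases h : ‖z‖ < R'
      · exact Or.inl ⟨hz, h⟩
      · exact Or.inr (not_lt.1 h)
    · rintro (⟨h, -⟩ | h)
      · exact h
      · exact hRR'.trans h
  have hdisj : Disjoint A {z : EuclideanSpace ℝ (Fin 3) | R' ≤ ‖z‖} := by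
    rw [Set.disjoint_left]
    intro z hz hz'
    have : R' ≤ ‖z‖ := hz'
    linarith [hz.2]
  have hint := integrableOn_pressureKernel_far hVm hV2 hR hy.le
  rw [hunion] at hint ⊢
  rw [setIntegral_union hdisj (measurableSet_le measurable_const measurable_norm)
    (hint.mono_set subset_union_left) (hint.mono_set subset_union_right),
    hya, hrep', hUAint]
  ring

end Consistency

end Summit.NavierStokesRegularity.NavierStokesRegularity.Theorems.PowerGaugeEulerLiouville
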